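import Summits.ResolutionOfSingularities.ResolutionOfSingularities.Theorems.HilbertSamuelEliminationSigmaMaxModificationsCorridor3WLadderIsoTailsBaseChangePsi
import Summits.ResolutionOfSingularities.ResolutionOfSingularities.Theorems.HilbertSamuelEliminationSigmaMaxModificationsCorridor3WLadderIsoTailsSeparableBaseChangeLocal
import Summits.ResolutionOfSingularities.ResolutionOfSingularities.Theorems.HilbertSamuelEliminationSigmaMaxModificationsCorridor3WLadderIsoTailsHSArc
import HarnessLib

/-!
# [OURS · L1 W4.2] K2-sep ROUTE A, brick (β) assembled on affine pieces: **`H^N_{Spec(A ⊗ₖ K)}(𝔓) = H^N_{Spec A}(𝔓 ∩ A)` at EVERY prime**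
# for `A` of finite type over `k` and `K/k` SEPARABLE algebraic of any degree ((β1) `H^{(0)}` by flatness with field fibre + (β2) `ψ` by
# dimension theory; CJS Def. 2.28: `H^N = H^{(N − ψ)}`)
# (crux `SigmaMaxModifications` stmt-ResolutionOfSingularities-18506 / conjunct stmt-…-19249; line `w_ladder_rows` v8.5, registered stub
# `stub_isoSepRecurrent`; res-L1-w42-plan-1 WORD 2026-08-27T16:25:47Z; design `L/res-L1-w42-stub-2/k2sep/K2SEP-DESIGN.md` §6)

Prover res-L1-w42-stub-2 (gen 5). Helper file `--supports stmt-ResolutionOfSingularities-19249 --as helper`; no definitions, no named fact. OURS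
(cell res-hironaka, slot W4.2); NOT statements of [Hironaka2017] nor of [CossartJannsenSaito2020]. AI-written; AI review is weaker than expert
review. This is the affine form of «`H_{X ×_k K}(x′) = H_X(pr x′)`»; the global form follows by `Scheme.hsFun_eq_of_isOpenImmersion` on affine
charts (brick (δ)).

* `hilbertSamuelFun_localization_tensorProduct_eq` — `H^{(t)}[(A ⊗ₖ K)_𝔓] = H^{(t)}[A_𝔭]` for all `t`.
* **`hsFun_spec_tensorProduct_eq`** — `Scheme.hsFun (Spec (A ⊗ₖ K)) N 𝔓 = Scheme.hsFun (Spec A) N (𝔓 ∩ A)`.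

[OURS · L1 W4.2; AI-written] [cite: CossartJannsenSaito2020, Def. 2.28, Lemma 2.27 (1)] [cite: GortzWedhorn2020, Prop. 5.38]
-/

set_option linter.dupNamespace false

noncomputable section

open scoped TensorProduct
open CategoryTheory AlgebraicGeometry IsLocalRing
open Literature.RingTheory.HilbertSamuel Literature.AlgebraicGeometry.Resolution

namespace Summit.ResolutionOfSingularities.ResolutionOfSingularities.Theorems.SigmaMaxModificationsCorridor3.IsoTailsHS

universe u

variable {k K A : Type u} [Field k] [Field K] [Algebra k K] [Algebra.IsSeparable k K] [CommRing A] [Algebra k A]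
  [Algebra.FiniteType k A] [IsNoetherianRing A] [IsNoetherianRing (A ⊗[k] K)]

omit [Algebra.FiniteType k A] in
/-- **`H^{(t)}[(A ⊗ₖ K)_𝔓] = H^{(t)}[A_𝔭]` for every `t`** (from (β1) `hilbertFun_localization_tensorProduct_eq`).
[cite: CossartJannsenSaito2020, Lemma 2.27 (1)] -/
theorem hilbertSamuelFun_localization_tensorProduct_eq (𝔓 : Ideal (A ⊗[k] K)) [𝔓.IsPrime] (t : ℕ) :
    hilbertSamuelFun (Localization.AtPrime 𝔓) t = hilbertSamuelFun (Localization.AtPrime (𝔓.under A)) t := by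
  show iterPSum t (hilbertFun (Localization.AtPrime 𝔓)) = iterPSum t (hilbertFun (Localization.AtPrime (𝔓.under A)))
  rw [hilbertFun_localization_tensorProduct_eq (k := k) (A := A) 𝔓]

/-- **`H^N_{Spec(A ⊗ₖ K)}(𝔓) = H^N_{Spec A}(𝔓 ∩ A)` AT EVERY PRIME** for `A` of finite type over `k`, `K/k` separable algebraic of any degree:
CJS's `H^N = H^{(N − ψ)}` read in the localizations (`hsFun_Spec_eq`), with `H^{(t)}` from (β1) and `ψ` from (β2)
`minimalPrimesCodim_localization_tensorProduct_eq`. [cite: CossartJannsenSaito2020, Def. 2.28, Lemma 2.27 (1)] [cite: GortzWedhorn2020, Prop. 5.38] -/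
theorem hsFun_spec_tensorProduct_eq (N : ℕ) (x' : ↥(Spec (CommRingCat.of (A ⊗[k] K)))) :
    Scheme.hsFun (Spec (CommRingCat.of (A ⊗[k] K))) N x' =
      Scheme.hsFun (Spec (CommRingCat.of A)) N ⟨x'.asIdeal.under A, Ideal.IsPrime.under A x'.asIdeal⟩ := by
  rw [hsFun_Spec_eq N x' (Localization.AtPrime x'.asIdeal),
    hsFun_Spec_eq N (⟨x'.asIdeal.under A, Ideal.IsPrime.under A x'.asIdeal⟩ : ↥(Spec (CommRingCat.of A)))
      (Localization.AtPrime (x'.asIdeal.under A)),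
    minimalPrimesCodim_localization_tensorProduct_eq (k := k) (A := A) x'.asIdeal,
    hilbertSamuelFun_localization_tensorProduct_eq (k := k) (A := A) x'.asIdeal]

end Summit.ResolutionOfSingularities.ResolutionOfSingularities.Theorems.SigmaMaxModificationsCorridor3.IsoTailsHS

end
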